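import Summits.ABC.ABC.Theorems.StewartTijdeman1986Holds
import HarnessLib

/-!
# The odd-prime `p`-adic socket with its constant WRITTEN OUT (papers lane ABC-P1, writer seat; theorems only)

`Summits/ABC/ABC/Theorems/AbcExplicitSocket.lean`.  The socket theorems of
`Summits/ABC/StewartYu/PrimePadicSocket{Tools,Odd}.lean` (cell `abc-stewartyu`) conclude `BakerShapeBound θ 0 = ∃ κ, …`;
their proofs instantiate `κ` by explicit terms.  This file re-runs those proofs VERBATIM with the existential opened, so
that a closed-form constant can be read off by composition (sequel: `AbcExplicitRadPowSix.lean`):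
`pow_card_le_prod_rpow_explicit` (= `StewartTijdemanGeneric.exists_pow_card_le_prod_rpow` with its witness
`A = C^⌈C^{1/η}⌉₊` in the statement), `log_le_explicit_of_loglog_rpow` (= `bakerShapeBound_of_loglog_rpow` with
`κ₀ = (3 + 3M((τ+1)/δ)^τ)^{1/(1−2δ)}`), `log_le_explicit_of_oddPrimePadicBound_general` and
`log_le_explicit_of_oddPrime_logRadShape` (= `bakerShapeBound_of_oddPrimePadicBound_general` /
`bakerShapeBound_of_oddPrime_logRadShape` with the constant written out).  No new definition, no new mathematics:
[folklore] bookkeeping; proofs copied from the cell's files (seat p3) with the last `refine ⟨κ, …⟩` removed.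
-/

set_option linter.dupNamespace false

noncomputable section

open Finset Real
open Literature.NumberTheory.DiophantineGeometry
open Literature.Barriers.ABC Literature.Barriers.ABC.StewartTijdemanGeneric

namespace Summit.ABC.ABC.Theorems

open Summit.ABC.StewartYu

/-- `C^{#S} ≤ C^{⌈C^{1/η}⌉} · (∏ S)^η` for finite sets `S` of primes — `exists_pow_card_le_prod_rpow` with its witness in the
statement. [folklore] -/
theorem pow_card_le_prod_rpow_explicit {C η : ℝ} (hC : 1 ≤ C) (hη : 0 < η)
    (S : Finset ℕ) (hS : ∀ q ∈ S, q.Prime) :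
    C ^ S.card ≤ C ^ ⌈C ^ (1 / η)⌉₊ * (((∏ q ∈ S, q : ℕ)) : ℝ) ^ η := by
  classical
  set T : ℕ := ⌈C ^ (1 / η)⌉₊ with hT
  have hC0 : 0 ≤ C := zero_le_one.trans hC
  set S₁ := S.filter (fun q => q < T) with hS₁
  set S₂ := S.filter (fun q => ¬ q < T) with hS₂
  have hcard : S.card = S₁.card + S₂.card := (Finset.card_filter_add_card_filter_not _).symm
  -- the small primes
  have h₁ : C ^ S₁.card ≤ C ^ T := by
    apply pow_le_pow_right₀ hC
    calc S₁.card ≤ (Finset.range T).card :=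
          Finset.card_le_card fun q hq => Finset.mem_range.mpr (Finset.mem_filter.mp hq).2
      _ = T := Finset.card_range T
  -- the large primes
  have hCT : C ≤ (T : ℝ) ^ η := by
    have h1 : C = (C ^ (1 / η)) ^ η := by
      rw [one_div, Real.rpow_inv_rpow hC0 hη.ne']
    have h2 : C ^ (1 / η) ≤ (T : ℝ) := Nat.le_ceil _
    rw [h1]
    exact Real.rpow_le_rpow (Real.rpow_nonneg hC0 _) h2 hη.le
  have h₂ : C ^ S₂.card ≤ (((∏ q ∈ S₂, q : ℕ)) : ℝ) ^ η := by
    rw [← Finset.prod_const C, Nat.cast_prod, ← Real.finsetProd_rpow _ _ (fun q _ => by positivity)]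
    refine Finset.prod_le_prod (fun _ _ => hC0) fun q hq => ?_
    have hqT : T ≤ q := not_lt.mp (Finset.mem_filter.mp hq).2
    exact hCT.trans (Real.rpow_le_rpow (Nat.cast_nonneg _) (by exact_mod_cast hqT) hη.le)
  have h₃ : (((∏ q ∈ S₂, q : ℕ)) : ℝ) ^ η ≤ (((∏ q ∈ S, q : ℕ)) : ℝ) ^ η := by
    refine Real.rpow_le_rpow (by positivity) ?_ hη.le
    exact_mod_cast Finset.prod_le_prod_of_subset_of_one_le' (Finset.filter_subset _ S)
      fun q hq _ => (hS q hq).one_lt.le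
  calc C ^ S.card = C ^ S₁.card * C ^ S₂.card := by rw [hcard, pow_add]
    _ ≤ C ^ T * (((∏ q ∈ S, q : ℕ)) : ℝ) ^ η :=
        mul_le_mul h₁ (h₂.trans h₃) (pow_nonneg hC0 _) (pow_nonneg hC0 _)

/-- The endgame with a power of `log c`, explicit constant: `bakerShapeBound_of_loglog_rpow` with its witness
`κ₀ = (3 + 3·M·((τ+1)/δ)^τ)^{1/(1−2δ)}` in the statement. [folklore] -/
theorem log_le_explicit_of_loglog_rpow {μ θ δ M : ℝ} {τ : ℕ} (hμ0 : 0 ≤ μ) (hδ : 0 < δ)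
    (h2δ : 2 * δ < 1) (hθ : μ ≤ θ * (1 - 2 * δ)) (hM : 0 ≤ M)
    (h : ∀ a b c : ℕ, IsABCTriple a b c →
      Real.log c ≤ M * (rad a b c : ℝ) ^ μ * (max 3 (Real.log c)) ^ δ *
        Real.log (max 3 (Real.log c)) ^ τ) :
    ∀ a b c : ℕ, IsABCTriple a b c →
      Real.log c ≤ (3 + M * (((τ : ℝ) + 1) / δ) ^ τ * 3) ^ (1 / (1 - 2 * δ)) * (rad a b c : ℝ) ^ θ := by
  set Cτ : ℝ := ((τ + 1) / δ) ^ τ with hCτ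
  have hCτ0 : 0 ≤ Cτ := pow_nonneg (by positivity) τ
  set γ : ℝ := 1 - 2 * δ with hγ
  have hγ0 : 0 < γ := by rw [hγ]; linarith
  have hθ0 : 0 ≤ θ := by
    by_contra hneg
    push Not at hneg
    have : θ * (1 - 2 * δ) < 0 := mul_neg_of_neg_of_pos hneg hγ0
    linarith
  set κ₀ : ℝ := (3 + M * Cτ * 3) ^ (1 / γ) with hκ₀
  intro a b c ht
  show Real.log c ≤ κ₀ * (rad a b c : ℝ) ^ θ
  have hmain := h a b c ht
  obtain ⟨ha, hb, habc, -⟩ := ht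
  set R : ℝ := (rad a b c : ℝ) with hR
  have hR1 : 1 ≤ R := one_le_rad_real a b c
  set y : ℝ := Real.log c with hy
  have hc1 : (1 : ℝ) ≤ c := by exact_mod_cast (show 1 ≤ c by omega)
  have hy0 : 0 ≤ y := Real.log_nonneg hc1
  set Y : ℝ := max 3 y with hYdef
  have hY1 : 1 ≤ Y := le_trans (by norm_num) (le_max_left _ _)
  have hY0 : 0 ≤ Y := zero_le_one.trans hY1
  have hY3 : Y ≤ 3 + y := max_le (by linarith) (by linarith)
  set u : ℝ := 3 + y with hu
  have hu1 : 1 ≤ u := by rw [hu]; linarith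
  have hu0 : 0 ≤ u := zero_le_one.trans hu1
  -- `y ≤ M' u^{2δ}`
  set M' : ℝ := M * Cτ * 3 * R ^ μ with hM'
  have hRμ1 : 1 ≤ R ^ μ := Real.one_le_rpow hR1 hμ0
  have hM'0 : 0 ≤ M' := by rw [hM']; positivity
  have h1 : y ≤ M' * u ^ (2 * δ) := by
    have hlog := log_pow_le_mul_rpow hδ τ hY1
    have hYu : Y ^ δ ≤ u ^ δ := Real.rpow_le_rpow hY0 hY3 hδ.le
    have hYu2 : Y ^ δ * Y ^ δ ≤ u ^ (2 * δ) := by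
      rw [two_mul, Real.rpow_add (by linarith : (0 : ℝ) < u)]
      exact mul_le_mul hYu hYu (Real.rpow_nonneg hY0 δ) (Real.rpow_nonneg hu0 δ)
    calc y ≤ M * R ^ μ * Y ^ δ * Real.log Y ^ τ := hmain
      _ ≤ M * R ^ μ * Y ^ δ * (Cτ * Y ^ δ) :=
          mul_le_mul_of_nonneg_left hlog (by positivity)
      _ = M * Cτ * R ^ μ * (Y ^ δ * Y ^ δ) := by ring
      _ ≤ M * Cτ * R ^ μ * u ^ (2 * δ) := mul_le_mul_of_nonneg_left hYu2 (by positivity)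
      _ ≤ M' * u ^ (2 * δ) := by
          rw [hM']
          have : M * Cτ * R ^ μ ≤ M * Cτ * 3 * R ^ μ := by nlinarith [mul_nonneg hM hCτ0]
          exact mul_le_mul_of_nonneg_right this (Real.rpow_nonneg hu0 _)
  -- `u ≤ (3 + M') u^{2δ}`, so `u^{γ} ≤ 3 + M'`
  have hu2δ : 1 ≤ u ^ (2 * δ) := Real.one_le_rpow hu1 (by linarith)
  have h2 : u ≤ (3 + M') * u ^ (2 * δ) := by
    calc u = 3 + y := rfl
      _ ≤ 3 * u ^ (2 * δ) + M' * u ^ (2 * δ) := by nlinarith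
      _ = (3 + M') * u ^ (2 * δ) := by ring
  have h3 : u ^ γ ≤ 3 + M' := by
    have hsplit : u = u ^ γ * u ^ (2 * δ) := by
      rw [← Real.rpow_add (by linarith : (0 : ℝ) < u), hγ]; norm_num
    have hpos : 0 < u ^ (2 * δ) := by linarith
    rw [hsplit] at h2
    exact le_of_mul_le_mul_right (by linarith [h2]) hpos
  -- `u ≤ (3 + M')^{1/γ} ≤ κ₀ R^{θ}`
  have h4 : u ≤ (3 + M') ^ (1 / γ) := by
    have h := Real.rpow_le_rpow (Real.rpow_nonneg hu0 _) h3 (by positivity : (0:ℝ) ≤ 1 / γ)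
    rwa [← Real.rpow_mul hu0, mul_one_div_cancel hγ0.ne', Real.rpow_one] at h
  have h5 : (3 + M') ^ (1 / γ) ≤ κ₀ * R ^ θ := by
    have hle : 3 + M' ≤ (3 + M * Cτ * 3) * R ^ μ := by
      rw [hM']; nlinarith [mul_nonneg (mul_nonneg hM hCτ0) (by norm_num : (0:ℝ) ≤ 3)]
    calc (3 + M') ^ (1 / γ) ≤ ((3 + M * Cτ * 3) * R ^ μ) ^ (1 / γ) :=
          Real.rpow_le_rpow (by linarith) hle (by positivity)
      _ = κ₀ * (R ^ μ) ^ (1 / γ) := by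
          rw [hκ₀, Real.mul_rpow (by positivity) (by positivity)]
      _ = κ₀ * R ^ (μ * (1 / γ)) := by rw [← Real.rpow_mul (by linarith)]
      _ ≤ κ₀ * R ^ θ := by
          apply mul_le_mul_of_nonneg_left _ (by positivity)
          apply Real.rpow_le_rpow_of_exponent_le hR1
          rw [mul_one_div, div_le_iff₀ hγ0, hγ]
          exact hθ
  calc y ≤ u := by rw [hu]; linarith
    _ ≤ κ₀ * R ^ θ := h4.trans h5

/-- The odd-prime socket with its constant written out (`bakerShapeBound_of_oddPrimePadicBound_general`, verbatim proof,
existential opened). [folklore] -/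
theorem log_le_explicit_of_oddPrimePadicBound_general {K L κ σ : ℝ} {τ₀ τ₁ : ℕ} (hK : 0 ≤ K)
    (hL : 1 ≤ L) (hκ0 : 0 ≤ κ) (hσ0 : 0 ≤ σ)
    (hP : ∀ (p n : ℕ) (q : Fin n → ℕ) (e : Fin n → ℤ), p.Prime → 3 ≤ p →
      (∀ i, (q i).Prime) → Function.Injective q → (∀ i, q i ≠ p) → e ≠ 0 →
      ∏ i, ((q i : ℚ)) ^ e i ≠ 1 →
      (padicValRat p (∏ i, ((q i : ℚ)) ^ e i - 1) : ℝ) ≤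
        K * L ^ n * (n : ℝ) ^ (κ * n) * (p : ℝ) ^ σ * (∏ i, Real.log (q i)) *
          (Real.log (max 3 ((Finset.univ.sup fun i => (e i).natAbs : ℕ) : ℝ)) + Real.log p +
            ∑ i, Real.log (q i)) ^ (τ₀ + τ₁ * n)) :
    ∀ a b c : ℕ, IsABCTriple a b c →
      Real.log c ≤
        (3 + (3 * (48 * K * ((4 * L * Real.exp κ * (((τ₁ : ℝ) + 1) / (1 / (8 * (κ + σ + 3 * τ₁ + 1)))) ^ τ₁) ^
              ⌈(4 * L * Real.exp κ * (((τ₁ : ℝ) + 1) / (1 / (8 * (κ + σ + 3 * τ₁ + 1)))) ^ τ₁) ^ (1 / (1 / 8 : ℝ))⌉₊) *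
              Real.exp τ₁ * (16 * ((τ₀ : ℝ) + 1)) ^ τ₀) + 1) *
            (((τ₀ : ℝ) + 1) / (1 / (8 * (κ + σ + 3 * τ₁ + 1)))) ^ τ₀ * 3) ^ (1 / (1 - 2 * (1 / (8 * (κ + σ + 3 * τ₁ + 1))))) *
        (rad a b c : ℝ) ^ (κ + σ + 3 * τ₁ + 1) := by
  classical
  set θ : ℝ := κ + σ + 3 * τ₁ + 1 with hθ
  set μ : ℝ := κ + σ + 3 * τ₁ + 5 / 8 with hμ
  have hθ1 : 1 ≤ θ := by
    rw [hθ]; have : (0 : ℝ) ≤ 3 * (τ₁ : ℝ) := by positivity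
    linarith
  have hθ0 : 0 < θ := by linarith
  have hμ0 : 0 ≤ μ := by rw [hμ]; positivity
  set δ : ℝ := 1 / (8 * θ) with hδ
  have hδ0 : 0 < δ := by rw [hδ]; positivity
  have hδθ : δ * θ = 1 / 8 := by rw [hδ]; field_simp
  have hδ1 : δ ≤ 1 := by
    rw [hδ, div_le_one (by positivity)]; linarith
  have h2δ : 2 * δ < 1 := by
    have : δ ≤ 1 / 8 := by rw [hδ]; exact one_div_le_one_div_of_le (by norm_num) (by linarith)
    linarith
  have hμθ : μ ≤ θ * (1 - 2 * δ) := by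
    have : θ * (1 - 2 * δ) = θ - 2 * (δ * θ) := by ring
    rw [this, hδθ, hμ, hθ]; linarith
  set C₀ : ℝ := 4 * L * Real.exp κ * (((τ₁ : ℝ) + 1) / δ) ^ τ₁ with hC₀
  have hC₀1 : 1 ≤ C₀ := by
    have h1 : 1 ≤ 4 * L * Real.exp κ := by
      nlinarith [Real.one_le_exp hκ0]
    have h2 : (1 : ℝ) ≤ ((τ₁ : ℝ) + 1) / δ := by
      rw [le_div_iff₀ hδ0]; nlinarith
    rw [hC₀]
    exact one_le_mul_of_one_le_of_one_le h1 (one_le_pow₀ h2)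
  set A : ℝ := C₀ ^ ⌈C₀ ^ (1 / (1 / 8 : ℝ))⌉₊ with hAdef
  have hA1 : 1 ≤ A := one_le_pow₀ hC₀1
  have hA : ∀ S : Finset ℕ, (∀ q ∈ S, q.Prime) →
      C₀ ^ S.card ≤ A * (((∏ q ∈ S, q : ℕ)) : ℝ) ^ (1 / 8 : ℝ) :=
    fun S hS => pow_card_le_prod_rpow_explicit hC₀1 (by norm_num : (0 : ℝ) < 1 / 8) S hS
  have hA0 : 0 ≤ A := zero_le_one.trans hA1
  set M₀ : ℝ := 48 * K * A * Real.exp τ₁ * (16 * ((τ₀ : ℝ) + 1)) ^ τ₀ with hM₀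
  have hM₀0 : 0 ≤ M₀ := by rw [hM₀]; positivity
  have key0 := log_le_explicit_of_loglog_rpow (μ := μ) (θ := θ) (τ := τ₀) (M := 3 * M₀ + 1) hμ0 hδ0 h2δ hμθ
    (by positivity) (fun a b c ht => ?_)
  · intro a b c ht
    have := key0 a b c ht
    simpa only [hM₀, hAdef, hC₀, hδ, hθ] using this
  -- symmetric in `a, b`: reduce to `a ≤ b`
  have hR1 : (1 : ℝ) ≤ (rad a b c : ℝ) := one_le_rad_real a b c
  have hRμ : (1 : ℝ) ≤ (rad a b c : ℝ) ^ μ := Real.one_le_rpow hR1 hμ0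
  set Y : ℝ := max 3 (Real.log c) with hYdef
  have hY3 : (3 : ℝ) ≤ Y := le_max_left _ _
  have hY1 : (1 : ℝ) ≤ Y := le_trans (by norm_num) hY3
  have hl3 : 1 ≤ Real.log 3 := by
    rw [Real.le_log_iff_exp_le (by norm_num)]
    exact Real.exp_one_lt_d9.le.trans (by norm_num)
  have hlogY1 : 1 ≤ Real.log Y := hl3.trans (Real.log_le_log (by norm_num) hY3)
  have hYδ : 1 ≤ Y ^ δ := Real.one_le_rpow hY1 hδ0.le
  have hlogYτ : 1 ≤ Real.log Y ^ τ₀ := one_le_pow₀ hlogY1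
  have hbig : 1 ≤ (rad a b c : ℝ) ^ μ * Y ^ δ * Real.log Y ^ τ₀ :=
    one_le_mul_of_one_le_of_one_le (one_le_mul_of_one_le_of_one_le hRμ hYδ) hlogYτ
  have hbig0 : 0 ≤ (rad a b c : ℝ) ^ μ * Y ^ δ * Real.log Y ^ τ₀ := zero_le_one.trans hbig
  -- the key bound for `a' < b'` (applied to `(a, b)` or `(b, a)`)
  have key : ∀ {a' b' : ℕ}, IsABCTriple a' b' c → a' < b' → rad a' b' c = rad a b c →
      Real.log c ≤ (3 * M₀ + 1) * (rad a b c : ℝ) ^ μ * Y ^ δ * Real.log Y ^ τ₀ := by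
    intro a' b' ht' hab hradeq
    obtain ⟨ha, hb, habc, hcop⟩ := ht'
    have hc0 : c ≠ 0 := by omega
    have hcpos : (0 : ℝ) < c := by exact_mod_cast (show 0 < c by omega)
    have hac : Nat.Coprime a' c := by rw [← habc]; exact Nat.coprime_self_add_right.mpr hcop
    have hbc : Nat.Coprime b' c := by rw [← habc]; exact Nat.coprime_add_self_right.mpr hcop.symm
    have hrad3 : ∀ x y z : ℕ, x * (y * z) = a' * b' * c →
        (((∏ q ∈ (x * (y * z)).primeFactors, q : ℕ)) : ℝ) = (rad a b c : ℝ) := by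
      intro x y z hxyz
      rw [← hradeq, rad_def, Nat.radical_eq_prod_primeFactors, hxyz]
    by_cases h2c : 2 ∣ c
    · -- `c` even: `a', b'` odd, expand `b'` (`b' ∣ c² − a'²`, `c < 2 b'`)
      have hb_odd : ¬ 2 ∣ b' := fun h =>
        (Nat.Prime.one_lt Nat.prime_two).ne' (Nat.eq_one_of_dvd_coprimes hbc h h2c)
      have hcopb : Nat.Coprime b' (c * a') := Nat.Coprime.mul_right hbc hcop.symm
      have hdvd : (b' : ℤ) ∣ (c : ℤ) ^ 2 - (a' : ℤ) ^ 2 :=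
        ⟨(c : ℤ) + a', by rw [← habc]; push_cast; ring⟩
      have hca : c ≠ a' := by omega
      have hmem := log_oddMember_le (c := c) hK hL hκ0 hσ0 hδ0 hδ1 hP hA0 hA hb (by omega) ha hca
        hac.symm hcopb hdvd hb_odd le_rfl (by omega)
      rw [hrad3 b' c a' (by ring)] at hmem
      have hc2b : (c : ℝ) ≤ 2 * b' := by exact_mod_cast (show c ≤ 2 * b' by omega)
      have hlogc : Real.log c ≤ Real.log 2 + Real.log b' := by
        rw [← Real.log_mul (by norm_num) (by exact_mod_cast hb.ne')]
        exact Real.log_le_log hcpos hc2b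
      have hlog2 : Real.log 2 ≤ 1 := by linarith [Real.log_two_lt_d9]
      calc Real.log c ≤ Real.log 2 + Real.log b' := hlogc
        _ ≤ 1 * ((rad a b c : ℝ) ^ μ * Y ^ δ * Real.log Y ^ τ₀) +
              3 * M₀ * (rad a b c : ℝ) ^ μ * Y ^ δ * Real.log Y ^ τ₀ := by
            apply add_le_add
            · rw [one_mul]; exact hlog2.trans hbig
            · rw [hM₀, hμ]; exact hmem
        _ = (3 * M₀ + 1) * (rad a b c : ℝ) ^ μ * Y ^ δ * Real.log Y ^ τ₀ := by ring
    · -- `c` odd: expand `c` (`c ∣ a'² − b'²`)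
      have hcopc : Nat.Coprime c (a' * b') := (Nat.Coprime.mul_left hac hbc).symm
      have hdvd : (c : ℤ) ∣ (a' : ℤ) ^ 2 - (b' : ℤ) ^ 2 :=
        ⟨(a' : ℤ) - b', by rw [← habc]; push_cast; ring⟩
      have hmem := log_oddMember_le (c := c) hK hL hκ0 hσ0 hδ0 hδ1 hP hA0 hA (by omega) ha hb
        (by omega) hcop hcopc hdvd h2c (by omega) (by omega)
      rw [hrad3 c a' b' (by ring)] at hmem
      calc Real.log c ≤ 3 * M₀ * (rad a b c : ℝ) ^ μ * Y ^ δ * Real.log Y ^ τ₀ := by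
            rw [hM₀, hμ]; exact hmem
        _ ≤ (3 * M₀ + 1) * (rad a b c : ℝ) ^ μ * Y ^ δ * Real.log Y ^ τ₀ := by
            have : 0 ≤ 1 * ((rad a b c : ℝ) ^ μ * Y ^ δ * Real.log Y ^ τ₀) := by positivity
            nlinarith
  obtain ⟨ha, hb, habc, hcop⟩ := ht
  rcases lt_trichotomy a b with hab | rfl | hba
  · exact key ⟨ha, hb, habc, hcop⟩ hab rfl
  · -- `a = b = 1`, `c = 2`
    have ha1 : a = 1 := Nat.Coprime.eq_one_of_dvd hcop (dvd_refl a)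
    have hc2 : c = 2 := by omega
    subst hc2
    have h2 : Real.log ((2 : ℕ) : ℝ) ≤ 1 := by
      push_cast; linarith only [Real.log_two_lt_d9]
    have h1 : (1 : ℝ) ≤ 3 * M₀ + 1 := by linarith
    calc Real.log ((2 : ℕ) : ℝ) ≤ 1 := h2
      _ ≤ (3 * M₀ + 1) * ((rad a a 2 : ℝ) ^ μ * Y ^ δ * Real.log Y ^ τ₀) :=
          one_le_mul_of_one_le_of_one_le h1 hbig
      _ = (3 * M₀ + 1) * (rad a a 2 : ℝ) ^ μ * Y ^ δ * Real.log Y ^ τ₀ := by ring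
  · have hrad : rad b a c = rad a b c := by rw [rad_def, rad_def, mul_comm b a]
    exact key ⟨hb, ha, by omega, hcop.symm⟩ hba hrad

/-- The `_logRad` shape of the one-prime bound at the odd primes gives `log c ≤ κ · rad^{κ+σ+1}` with `κ` written out
(`bakerShapeBound_of_oddPrime_logRadShape`, verbatim proof, existential opened). [folklore] -/
theorem log_le_explicit_of_oddPrime_logRadShape {K L κ σ : ℝ} {τ τ₁ : ℕ} (hK : 0 ≤ K) (hL : 1 ≤ L)
    (hκ0 : 0 ≤ κ) (hσ0 : 0 ≤ σ)
    (hP : ∀ (p : ℕ), p.Prime → p ≠ 2 → ∀ (n : ℕ) (q : Fin n → ℕ) (e : Fin n → ℤ),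
      (∀ i, (q i).Prime) → Function.Injective q → (∀ i, q i ≠ p) → e ≠ 0 →
      ∏ i, ((q i : ℚ)) ^ e i ≠ 1 →
      (padicValRat p (∏ i, ((q i : ℚ)) ^ e i - 1) : ℝ) ≤
        K * L ^ n * (n : ℝ) ^ (κ * n) * (p : ℝ) ^ σ * (∏ i, Real.log (q i)) *
          Real.log (max 3 ((Finset.univ.sup fun i => (e i).natAbs : ℕ) : ℝ)) ^ τ *
          Real.log (max 3 (∏ i, ((q i : ℕ) : ℝ))) ^ τ₁) :
    ∀ a b c : ℕ, IsABCTriple a b c →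
      Real.log c ≤
        (3 + (3 * (48 * K * ((4 * L * Real.exp κ) ^ ⌈(4 * L * Real.exp κ) ^ (1 / (1 / 8 : ℝ))⌉₊) *
              (16 * (((τ + τ₁ : ℕ) : ℝ) + 1)) ^ (τ + τ₁)) + 1) *
            ((((τ + τ₁ : ℕ) : ℝ) + 1) / (1 / (8 * (κ + σ + 1)))) ^ (τ + τ₁) * 3) ^
          (1 / (1 - 2 * (1 / (8 * (κ + σ + 1))))) *
        (rad a b c : ℝ) ^ (κ + σ + 1) := by
  have h := log_le_explicit_of_oddPrimePadicBound_general (τ₀ := τ + τ₁) (τ₁ := 0) hK hL hκ0 hσ0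
    (fun p n q e hp hp3 hq hinj hqp he hne1 => by
      have hp2 : p ≠ 2 := by omega
      have key := hP p hp hp2 n q e hq hinj hqp he hne1
      refine key.trans ?_
      -- compare the logarithmic factors
      set S : ℝ := Real.log (max 3 ((Finset.univ.sup fun i => (e i).natAbs : ℕ) : ℝ)) + Real.log p +
        ∑ i, Real.log (q i) with hS
      have hl3 : 1 ≤ Real.log 3 := by
        rw [Real.le_log_iff_exp_le (by norm_num)]
        exact Real.exp_one_lt_d9.le.trans (by norm_num)
      have hLB3 : Real.log 3 ≤ Real.log (max 3 ((Finset.univ.sup fun i => (e i).natAbs : ℕ) : ℝ)) :=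
        Real.log_le_log (by norm_num) (le_max_left _ _)
      have hLB0 : 0 ≤ Real.log (max 3 ((Finset.univ.sup fun i => (e i).natAbs : ℕ) : ℝ)) := by
        linarith
      have hlp0 : 0 ≤ Real.log p := Real.log_nonneg (by exact_mod_cast hp.one_lt.le)
      have hsum0 : 0 ≤ ∑ i, Real.log (q i) := Finset.sum_nonneg fun i _ =>
        Real.log_nonneg (by exact_mod_cast (hq i).one_lt.le)
      have hLB_le : Real.log (max 3 ((Finset.univ.sup fun i => (e i).natAbs : ℕ) : ℝ)) ≤ S := by
        rw [hS]; linarith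
      have hP1 : (1 : ℝ) ≤ ∏ i, ((q i : ℕ) : ℝ) := by
        rw [← Nat.cast_prod]; exact_mod_cast Finset.prod_pos fun i _ => (hq i).pos
      have hLQ_le : Real.log (max 3 (∏ i, ((q i : ℕ) : ℝ))) ≤ S := by
        have hle : max 3 (∏ i, ((q i : ℕ) : ℝ)) ≤ 3 * ∏ i, ((q i : ℕ) : ℝ) :=
          max_le (by linarith) (by linarith)
        have hlogP : Real.log (∏ i, ((q i : ℕ) : ℝ)) = ∑ i, Real.log (q i) :=
          Real.log_prod (s := Finset.univ) (fun i _ => by exact_mod_cast (hq i).ne_zero)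
        calc Real.log (max 3 (∏ i, ((q i : ℕ) : ℝ))) ≤ Real.log (3 * ∏ i, ((q i : ℕ) : ℝ)) :=
              Real.log_le_log (lt_of_lt_of_le (by norm_num) (le_max_left _ _)) hle
          _ = Real.log 3 + ∑ i, Real.log (q i) := by
              rw [Real.log_mul (by norm_num) (by linarith), hlogP]
          _ ≤ S := by rw [hS]; linarith
      have hLQ0 : 0 ≤ Real.log (max 3 (∏ i, ((q i : ℕ) : ℝ))) :=
        Real.log_nonneg (le_trans (by norm_num) (le_max_left _ _))
      have hlogs : Real.log (max 3 ((Finset.univ.sup fun i => (e i).natAbs : ℕ) : ℝ)) ^ τ *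
          Real.log (max 3 (∏ i, ((q i : ℕ) : ℝ))) ^ τ₁ ≤ S ^ (τ + τ₁ + 0 * n) := by
        rw [zero_mul, add_zero, pow_add]
        exact mul_le_mul (pow_le_pow_left₀ hLB0 hLB_le τ) (pow_le_pow_left₀ hLQ0 hLQ_le τ₁)
          (pow_nonneg hLQ0 τ₁) (pow_nonneg (hLB0.trans hLB_le) τ)
      have hpre : 0 ≤ K * L ^ n * (n : ℝ) ^ (κ * n) * (p : ℝ) ^ σ * (∏ i, Real.log (q i)) := by
        have : 0 ≤ L ^ n := pow_nonneg (zero_le_one.trans hL) n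
        have : 0 ≤ ∏ i, Real.log (q i) := Finset.prod_nonneg fun i _ =>
          Real.log_nonneg (by exact_mod_cast (hq i).one_lt.le)
        positivity
      calc K * L ^ n * (n : ℝ) ^ (κ * n) * (p : ℝ) ^ σ * (∏ i, Real.log (q i)) *
            Real.log (max 3 ((Finset.univ.sup fun i => (e i).natAbs : ℕ) : ℝ)) ^ τ *
            Real.log (max 3 (∏ i, ((q i : ℕ) : ℝ))) ^ τ₁
          = K * L ^ n * (n : ℝ) ^ (κ * n) * (p : ℝ) ^ σ * (∏ i, Real.log (q i)) *
            (Real.log (max 3 ((Finset.univ.sup fun i => (e i).natAbs : ℕ) : ℝ)) ^ τ *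
            Real.log (max 3 (∏ i, ((q i : ℕ) : ℝ))) ^ τ₁) := by ring
        _ ≤ K * L ^ n * (n : ℝ) ^ (κ * n) * (p : ℝ) ^ σ * (∏ i, Real.log (q i)) *
            S ^ (τ + τ₁ + 0 * n) := mul_le_mul_of_nonneg_left hlogs hpre)
  intro a b c ht
  have h1 := h a b c ht
  simp only [Nat.cast_zero, mul_zero, add_zero, zero_add, pow_zero, mul_one, Real.exp_zero] at h1
  exact h1

end Summit.ABC.ABC.Theorems

end
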